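import Summits.BirchSwinnertonDyer.Rank1Residual.Partition.CornersThree
import Summits.BirchSwinnertonDyer.Rank1Residual.Partition.CornersSchneider
import Literature.NumberTheory.EllipticCurves.Rank1Residual.X1RankOneOddPrime
import Literature.NumberTheory.EllipticCurves.Rank1Residual.ClassX1Isogeny
import Literature.NumberTheory.EllipticCurves.Wuthrich2014.ShaBoundProofs
import Literature.NumberTheory.EllipticCurves.ComplexMultiplicationLFunctionIsogenyHoldsProofs
import Literature.NumberTheory.EllipticCurves.AnalyticRankOrderProofs
import HarnessLib

/-!
# Class X1 (Eisenstein ANOMALOUS good `p`) = residual classes N1 / N1′ / N1″: the CLASS-CLOSURE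
# sub-partition by name, the type-B corner LEAVES the `p = 3` partition modulo the Schneider
# certificate, and the rank-one isogeny transport (cell `b2b-bsdres`, lane CLASS-CLOSURE, seat `cc-typer-6`)

HONEST FRAMING (run/shared/lean/b2b/bsd-rank1-residual/, verbatim in every file): the goal of the
cell is to DELETE the COMBINATION-SHAPED residual classes of the Birch–Swinnerton-Dyer formula for
ALL analytic-rank `≤ 1` elliptic curves over `ℚ` — "full BSD formula for every rank `≤ 1` curve in
class `C`" assembled STRICTLY from published theorems — so that the rank-`≤ 1` remainder becomes
exactly the CONSTRUCTION-SHAPED classes, which are TYPED (missing-input `Prop`s), NOT attempted.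
This is not "finishing BSD". Research routes; NO CLAIM BEYOND STATED CLASSES; nothing here changes a
label; the marks N1 (COMBINATION, announced) / N1′ (COVERED modulo Schneider) / N1″ (CONSTRUCTION by
label) are the referee's. Three definitions (the sub-partition predicates, in the atoms of
`Predicates.lean`); every theorem is over the tree's existing PUBLISHED named facts BY NAME — no
Keller–Yin input anywhere in this file; nothing about any particular curve is asserted.

## Class X1 (`ClassX1 W p := 2 < p ∧ red ∧ good ∧ anom ∧ ¬(r = 0 ∧ gvpar)`; sweep 10 062 pairs)

### (b) SUB-PARTITION (CLASS-CLOSURE-PLAN §3.8; RESIDUAL-MAP §I N1 / N1′ / N1″, §A anatomy note)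

| sub-cell (def below) | census | neighbouring PUBLISHED proof and the hypothesis that FAILS | closing statement in the kernel | residue named for ideation |
|---|---|---|---|---|
| `X1.TypeARankOne` = N1 (`r = 1`, `¬gvpar`) | 7 892 (7 522 @3) | CGS 2025 Thm. C/D, CGLS 2022 Thm. F: `φ∣_{G_p} ≠ 1, ω` FAILS (anomalous); GV 2000 (1.3): parity FAILS | per pair `X1.bsdp_of_shaAn_unit_odd` (`p ∤ #Ш_an` + Schneider certificate ⇒ BSD(E,p) AND Mazur's MC), every `p`; along the isogeny class `X1.bsdp_of_isIsogenous_shaAn_unit_of_schneider` (THIS FILE, Cassels) | type-A rank-one pairs with `p ∣ #Ш_an(E′)` for EVERY isogenous `E′`: Mazur's MC at the pair (`MazurMainConjectureOnX1TypeA`) ⟺ BSD(E,p) (kernel iff `X1.mainConjecture_iff_bsdp_of_analyticRank_eq_one`); announced: Keller–Yin Thm. 3 (PRE) |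
| `X1.TypeBRankOne` = N1′ (`r = 1`, `gvpar`) | 1 307 | MC PUBLISHED (GV (1.3), no anomaly hypothesis, odd `p`); leading terms Perrin-Riou–Schneider / Perrin-Riou 1987 at ODD `p` (x1b gen 4: `…_odd` facts) | **`bsdp_of_typeBRankOne_of_schneider` (every `p`, incl. `3`) and the Partition form `bsdp_three_or_cell_of_schneider` (THIS FILE): the X1 corner of the `p = 3` partition shrinks to `X1 ∧ ¬gvpar` modulo the pair's Schneider certificate** — VERBATIM-EXTENSION PART (instrument: `[T¹]L_3(E,T) ≠ 0`, PARI `ellpadicL`/`ellpadicregulator` at `p = 3`, Balakrishnan 2016) | Schneider's non-degeneracy class-wide (open conjecture; per pair a finite certificate) |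
| `X1.TypeARankZero` = N1″ (`r = 0`; `¬gvpar` forced) | 149–151 | GV (1.3) parity FAILS; CGS Thm. A anomaly FAILS | per pair Wuthrich Prop. 21 + Cassels (`X1.bsdp_of_shaAn_unit_of_isIsogenous'`, kernel sub-class C4; 770/770 window pairs) | type-A rank-zero pairs with `p ∣ #Ш_an` on every isogenous curve: `MazurMainConjecture W p` ⟺ BSD(E,p) (kernel iff, rank `0`) |

Exhaustive and disjoint: `X1.subcell_cases`, `X1.subcells_disjoint`.

### (c) TRANSPORT lemmas (all PUBLISHED antecedents; statements in the kernel)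
* isogeny (Cassels 1965 / Milne ADT I.7.3, fact `bsdRHS_eq_of_isIsogenous`): X1 and the parity type
  are isogeny-invariant (`ClassX1.of_isIsogenous`, `gvPar_iff_of_isIsogenous_of_anom`), so an isogeny
  never leaves the sub-cell; what it transports is the CERTIFICATE: `#Ш_an` and `μ` vary inside the
  class (Mazur's `X₀(11)` at `5`; Greenberg LNM 1716 p. 64). Rank `0`: `X1.bsdp_of_shaAn_unit_of_
  isIsogenous'` (gen 1). Rank `1`: `X1.bsdp_of_isIsogenous_shaAn_unit_of_schneider` (THIS FILE).
* quadratic twist (CGLS 2022 Thm. 5.3.1's device, `L(E^K,1) ≠ 0`): the partner of a type-A rank-one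
  pair is TYPE B rank `0`, CLOSED by GV (1.3) — `pPartRankZero_twist_of_not_gvPar`
  (`ClassX1KellerYinTypeA.lean`); the partner of a type-B rank-one pair is type A rank `0` (N1″) —
  `PartnerPPartRankZeroOnX1` (typed). The transport statement needed on N1 is Keller–Yin's display
  (`KellerYin2024.thm421_rankOne_display_OPEN`, PRE), typed by x1a.
* congruence / base change: none in print for an anomalous Eisenstein prime (route G of X2 runs the
  other way: FROM a good non-anomalous relative).

### (a) STATEMENT DISCOVERY: no census fit is proposed for N1 this week (CLASS-CLOSURE-PLAN §3.8,
ttrl2 line: "0–1 open window pairs; the seams are per-pair certificate-shaped"); the typed targets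
already in the tree are `MazurMainConjectureOnX1TypeA`, `BSDpOnClassX1`, `PartnerPPartRankZeroOnX1`
(`Rank1ResidualX1Defs`, `@[conjecture]`) and Keller–Yin's display. Nothing new is typed under (a).

References: RESIDUAL-MAP.md §A (RMAP NOTE 04:11Z), §I N1/N1′/N1″; CLASS-CLOSURE-PLAN.md §3.8;
[GreenbergVatsal2000] Thm. (1.3); [PerrinRiou1987] §1.4 Cor. 1.8; [BalakrishnanMullerStein2015]
Thm. 1.7; [MazurSteinTate2006] Thm. 1.3; [Balakrishnan2016] §2, §4; [Wuthrich2014] Thm. 16, Prop. 21;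
[MilneADT2006] Thm. I.7.3; [Knapp1993] Thm. 11.67; [Miller2011LMS] Def. 1.1.
-/

set_option autoImplicit false

noncomputable section

open scoped Classical MatrixGroups ModularForm NumberField

open CongruenceSubgroup WeierstrassCurve Literature.NumberTheory.EllipticCurves
  Literature.NumberTheory.EllipticCurves.ModularForms
  Literature.NumberTheory.EllipticCurves.Rank1Residual
  Literature.NumberTheory.EllipticCurves.Rank1Residual.Typed
  Literature.NumberTheory.EllipticCurves.Wuthrich2014

namespace Summit.BirchSwinnertonDyer.Rank1Residual

/-! ## §1. The sub-partition of X1 by name (N1 / N1′ / N1″) -/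

namespace X1

section SubPartition

variable (W : WeierstrassCurve ℚ) [W.IsGloballyMinimal] (p : ℕ) [Fact p.Prime]

/-- **N1 = X1a ∩ {r = 1}: anomalous Eisenstein good prime, analytic rank one, parity TYPE A** (no
rational `p`-isogeny kernel of type (ramified ∧ even) ∨ (unramified ∧ odd)). RESIDUAL-MAP §I N1.
[folklore] -/
def TypeARankOne : Prop := ClassX1 W p ∧ W.analyticRank = 1 ∧ ¬ GVPar W p

/-- **N1′ = X1 ∩ {r = 1} of parity TYPE B** (`GVPar W p`; on X1 this forces `r = 1`).
RESIDUAL-MAP §I N1′. [folklore] -/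
def TypeBRankOne : Prop := ClassX1 W p ∧ W.analyticRank = 1 ∧ GVPar W p

/-- **N1″ = X1b ∩ {r = 0}** (parity type A is forced by the class clause `¬(r = 0 ∧ gvpar)`).
RESIDUAL-MAP §I N1″. [folklore] -/
def TypeARankZero : Prop := ClassX1 W p ∧ W.analyticRank = 0

/-- The three sub-cells EXHAUST X1 in analytic rank `≤ 1`. [folklore] -/
theorem subcell_cases (hr : W.analyticRank ≤ 1) (hX : ClassX1 W p) :
    TypeARankOne W p ∨ TypeBRankOne W p ∨ TypeARankZero W p := by
  rcases Nat.le_one_iff_eq_zero_or_eq_one.mp hr with h0 | h1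
  · exact Or.inr (Or.inr ⟨hX, h0⟩)
  · by_cases hg : GVPar W p
    · exact Or.inr (Or.inl ⟨hX, h1, hg⟩)
    · exact Or.inl ⟨hX, h1, hg⟩

/-- The three sub-cells are pairwise disjoint. [folklore] -/
theorem subcells_disjoint :
    ¬ (TypeARankOne W p ∧ TypeBRankOne W p) ∧ ¬ (TypeARankOne W p ∧ TypeARankZero W p) ∧
      ¬ (TypeBRankOne W p ∧ TypeARankZero W p) := by
  refine ⟨fun ⟨hA, hB⟩ ↦ hA.2.2 hB.2.2, fun ⟨hA, h0⟩ ↦ ?_, fun ⟨hB, h0⟩ ↦ ?_⟩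
  · have := hA.2.1; have := h0.2; omega
  · have := hB.2.1; have := h0.2; omega

/-- On N1″ the parity type is A: `ClassX1`'s clause `¬(r = 0 ∧ gvpar)` with `r = 0`. [folklore] -/
theorem not_gvPar_of_typeARankZero (h : TypeARankZero W p) : ¬ GVPar W p :=
  fun hg ↦ h.1.2.2.2.2 ⟨h.2, hg⟩

end SubPartition

/-! ## §2. N1′ (type B, rank one) at EVERY prime of the class, modulo the Schneider certificate -/

/-- **N1′ is closed modulo the pair's Schneider certificate at EVERY `p` of the class (`p = 3`
included)**: for `W/ℚ` globally minimal elliptic and a prime `p` with `X1.TypeBRankOne W p`, Miller's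
`BSD(E,p)` follows from PUBLISHED named facts — Greenberg–Vatsal 2000 Thm. (1.3) (`hGV`, odd `p`, no
anomaly hypothesis: Mazur's MC), Perrin-Riou–Schneider = BMS 2016 Thm. 1.7 at odd `p` (`hS`),
Perrin-Riou 1987 §1.4 at odd `p` (`hPR`), the Mazur–Tate `σ`-function at odd `p` (`hMT`), modularity
(`hmod`), GZK (`hGZK`) — granted Schneider's non-degeneracy of THE canonical cyclotomic `p`-adic height
(`hSch`; per pair the finite certificate `[T¹]L_p(E,T) ≠ 0`, `X1.schneider_of_coeff_one_ne_zero_odd`).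
A restatement of x1b's `X1.bsdp_of_gvPar_of_analyticRank_eq_one` on the named sub-cell.
[cite: GreenbergVatsal2000, Thm. (1.3)] [cite: PerrinRiou1987, §1.4 Cor. 1.8]
[cite: BalakrishnanMullerStein2015, Thm. 1.7] [cite: MazurSteinTate2006, Thm. 1.3] -/
theorem bsdp_of_typeBRankOne_of_schneider (hGV : GreenbergVatsal2000.thm13_charIdeal_eq_of_gvPar)
    (hS : Schneider1985_order_charGenerator_odd) (hPR : perrinRiou_rankOne_leadingTerms_odd)
    (hMT : mazur_tate_sigma_exists_odd) (hmod : nonempty_modularParametrizationData)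
    (hGZK : rank_eq_analyticRank_of_analyticRank_le_one)
    (W : WeierstrassCurve ℚ) [W.IsElliptic] [W.IsGloballyMinimal] (p : ℕ) [Fact p.Prime]
    (h : TypeBRankOne W p)
    (hSch : ∀ Dh : PAdicHeightData W p, Dh.IsCanonical → SchneiderConjecture Dh) : BSDp W p :=
  X1.bsdp_of_gvPar_of_analyticRank_eq_one hGV hS hPR hMT hmod hGZK W p h.1 h.2.1 h.2.2 hSch

end X1

/-! ## §3. The `p = 3` partition with the X1 corner shrunk to its type-A part modulo the certificate -/

section Three

variable {W : WeierstrassCurve ℚ} [W.IsElliptic] [W.IsGloballyMinimal]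

/-- **THE PARTITION AT `p = 3`, X1 CORNER SHARPENED MODULO THE SCHNEIDER CERTIFICATE** (companion of
rmap-3's `bsdp_three_or_cell` and of rmap-1's `CornersSchneider` at `p ≥ 5`). For EVERY globally
minimal elliptic `W/ℚ` of analytic rank `≤ 1`, granted the fourteen named published facts of the
covered rows at `3` plus the three odd-prime rank-one facts (BMS 1.7 `hS`, Perrin-Riou `hPR`, MST `σ`
`hMT`) and the pair's Schneider certificate at `3` when `r = 1` (`hSch`): EITHER `BSD(E,3)` holds, OR
`(W,3)` lies in one of the eleven named cells of RESIDUAL-MAP §S — with the Eisenstein-anomalous cell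
now `ClassX1 W 3 ∧ ¬GVPar W 3` (TYPE A only: N1@3 and N1″@3); the type-B rank-one pairs at `3` (N1′@3)
have left the corner. No mark moves: N1′ is 'COVERED modulo the certificate' at every `p`.
[cite: GreenbergVatsal2000, Thm. (1.3)] [cite: PerrinRiou1987, §1.4 Cor. 1.8]
[cite: BalakrishnanMullerStein2015, Thm. 1.7] [cite: MazurSteinTate2006, Thm. 1.3] -/
theorem bsdp_three_or_cell_of_schneider (hSk : Skinner2016.thmC_padicValRat_bsd_rank_zero)
    (hBCS : BurungaleCastellaSkinner2025.cor131_padicValRat_bsd_rank_le_one)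
    (hJSW : JetchevSkinnerWan2017.thm121_padicValRat_bsd_rank_one)
    (hCGS : CastellaGrossiSkinner2025.thmD_padicValRat_bsd_rank_le_one)
    (hGV : GreenbergVatsal2000.thm13_charIdeal_eq_of_gvPar) (hGr : greenberg_charValue_rankZero)
    (hmod : hasEntireLFunction_rat) (hmodP : nonempty_modularParametrizationData)
    (hGZK : rank_eq_analyticRank_of_analyticRank_le_one)
    (hCM : bsdTriple_of_hasCM_of_L_one_ne_zero) (hKob : Kobayashi2013.cor14_bsdp_of_cm_rank_one)
    (hYZ : YanZhu2026.thm415_padicValRat_bsd_rank_le_one)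
    (hW20 : Wuthrich2014.lemma20_surjective_threeAdic_of_semistable)
    (hLLT : LiLiuTian2024.thm11_bsdp_of_cm_rank_one)
    (hS : Schneider1985_order_charGenerator_odd) (hPR : perrinRiou_rankOne_leadingTerms_odd)
    (hMT : mazur_tate_sigma_exists_odd)
    (hr : W.analyticRank ≤ 1)
    (hSch : W.analyticRank = 1 → ∀ Dh : PAdicHeightData W 3, Dh.IsCanonical → SchneiderConjecture Dh) :
    BSDp W 3 ∨
      ((ClassX10 W 3 ∧ ¬ Surj W 3) ∨ (ClassX1 W 3 ∧ ¬ GVPar W 3) ∨ (ClassX6 W 3 ∧ W.analyticRank = 0) ∨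
        ClassX7 W 3 ∨ ClassX8 W 3 ∨ ClassX11a W 3 ∨ ClassX2 W 3 ∨ ClassX3 W 3 ∨ ClassX4 W 3 ∨
        ClassX11b W 3 ∨ CornerF W 3) := by
  rcases bsdp_three_or_cell (W := W) hSk hBCS hJSW hCGS hGV hGr hmod hmodP hGZK hCM hKob hYZ hW20 hLLT hr
    with h | h10 | h1 | hrest
  · exact Or.inl h
  · exact Or.inr (Or.inl h10)
  · by_cases hg : GVPar W 3
    · have h1r : W.analyticRank = 1 := analyticRank_eq_one_of_classX1_of_gvPar hr h1 hg
      exact Or.inl (X1.bsdp_of_typeBRankOne_of_schneider hGV hS hPR hMT hmodP hGZK W 3 ⟨h1, h1r, hg⟩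
        (hSch h1r))
    · exact Or.inr (Or.inr (Or.inl ⟨h1, hg⟩))
  · exact Or.inr (Or.inr (Or.inr hrest))

end Three

/-! ## §4. N1 (type A, rank one): the isogeny transport of the certificate route (Cassels) -/

namespace X1

/-- **Rank-one isogeny transport on X1 (Cassels): a `#Ш_an`-unit certificate on ANY isogenous curve
closes the pair.** For `ℚ`-isogenous globally minimal elliptic `W ∼ W'`, `ClassX1 W p`,
`ord_{s=1} L(E,s) = 1`: if `p ∤ #Ш(W'/ℚ)_an` (`hunit'`) and THE canonical `p`-adic height of `W'` is
non-degenerate (`hSch'`, the Schneider certificate of the isogenous curve), then `BSD(W,p)`. Proof: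
X1 and the analytic rank transport (`ClassX1.of_isIsogenous`, `analyticRank_eq_of_isIsogenous'`,
Knapp 11.67), x1b's `X1.bsdp_and_mainConjecture_of_analyticRank_eq_one_of_shaAn_unit` closes `(W',p)`
from PUBLISHED facts (Wuthrich Thm. 16 `hW16`, BMS 1.7 `hS`, Perrin-Riou `hPR`, MST `σ` `hMT`,
modularity `hmod`, GZK `hGZK`), and Cassels' invariance (`bsdp_of_isIsogenous`, fact `hCassels`)
carries `BSD(W',p)` to `W`. The rank-one twin of gen 1's `X1.bsdp_of_shaAn_unit_of_isIsogenous'`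
(Wuthrich Prop. 21, rank `0`); it shrinks N1's irreducible residue to the type-A rank-one pairs with
`p ∣ #Ш_an` on EVERY curve of the isogeny class. [cite: MilneADT2006, Thm. I.7.3]
[cite: Wuthrich2014, Thm. 16 and §6] [cite: PerrinRiou1987, §1.4 Cor. 1.8]
[cite: BalakrishnanMullerStein2015, Thm. 1.7] [cite: Knapp1993, Thm. 11.67] -/
theorem bsdp_of_isIsogenous_shaAn_unit_of_schneider (hCassels : bsdRHS_eq_of_isIsogenous)
    (hW16 : charIdeal_dvd_padicLFunction) (hS : Schneider1985_order_charGenerator_odd)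
    (hPR : perrinRiou_rankOne_leadingTerms_odd) (hMT : mazur_tate_sigma_exists_odd)
    (hmod : nonempty_modularParametrizationData) (hGZK : rank_eq_analyticRank_of_analyticRank_le_one)
    (W W' : WeierstrassCurve ℚ) [W.IsElliptic] [W'.IsElliptic] [W.IsGloballyMinimal]
    [W'.IsGloballyMinimal] (hiso : IsIsogenous W W') (p : ℕ) [Fact p.Prime]
    (hX : ClassX1 W p) (han : W.analyticRank = 1)
    (hunit' : ∃ q : ℚ, shaAn W' = (q : ℂ) ∧ padicValRat p q = 0)
    (hSch' : ∀ Dh : PAdicHeightData W' p, Dh.IsCanonical → SchneiderConjecture Dh) : BSDp W p := by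
  have hX' : ClassX1 W' p := ClassX1.of_isIsogenous hiso hX
  have han' : W'.analyticRank = 1 := (analyticRank_eq_of_isIsogenous' hiso).symm.trans han
  have hB' : BSDp W' p :=
    (X1.bsdp_and_mainConjecture_of_analyticRank_eq_one_of_shaAn_unit hW16 hS hPR hMT hmod hGZK W' p hX'
      han' hSch' hunit').1
  haveI : NeZero (W'.conductorNorm ℤ) := ⟨(W'.conductorNorm_pos_holds).ne'⟩
  obtain ⟨Dm⟩ := hmod W'
  have hlead' : W'.leadingLCoeff ≠ 0 := W'.leadingLCoeff_ne_zero_holds Dm.isNewformOf.hasEntireLFunction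
  exact bsdp_of_isIsogenous hCassels hiso (hGZK W' han'.le).2 hlead' hB'

/-- **N1 in the canonical shape: the certificate route reaches every pair of the isogeny class of a
certified curve** — `TypeARankOne W p` (or any rank-one X1 pair), an isogenous `W'` with
`p ∤ #Ш_an(W')` and its Schneider certificate ⟹ `BSD(W,p)`. [cite: MilneADT2006, Thm. I.7.3]
[cite: Wuthrich2014, Thm. 16 and §6] -/
theorem bsdp_of_typeARankOne_of_isIsogenous_shaAn_unit (hCassels : bsdRHS_eq_of_isIsogenous)
    (hW16 : charIdeal_dvd_padicLFunction) (hS : Schneider1985_order_charGenerator_odd)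
    (hPR : perrinRiou_rankOne_leadingTerms_odd) (hMT : mazur_tate_sigma_exists_odd)
    (hmod : nonempty_modularParametrizationData) (hGZK : rank_eq_analyticRank_of_analyticRank_le_one)
    (W W' : WeierstrassCurve ℚ) [W.IsElliptic] [W'.IsElliptic] [W.IsGloballyMinimal]
    [W'.IsGloballyMinimal] (hiso : IsIsogenous W W') (p : ℕ) [Fact p.Prime]
    (h : TypeARankOne W p)
    (hunit' : ∃ q : ℚ, shaAn W' = (q : ℂ) ∧ padicValRat p q = 0)
    (hSch' : ∀ Dh : PAdicHeightData W' p, Dh.IsCanonical → SchneiderConjecture Dh) : BSDp W p :=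
  bsdp_of_isIsogenous_shaAn_unit_of_schneider hCassels hW16 hS hPR hMT hmod hGZK W W' hiso p h.1 h.2.1
    hunit' hSch'

end X1

end Summit.BirchSwinnertonDyer.Rank1Residual

end
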